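import Literature.Topology.Immersions.OpenParallelizableImmersionCritical
import Literature.Topology.FourManifolds.OpenManifoldMorseFunction
import Literature.Topology.FourManifolds.MorseLemma
import HarnessLib

/-!
# Submersions of open parallelizable manifolds: the Morse-theoretic exhaustion

Topic `Literature/Topology/Immersions`; the last reduction of the Gromov–Eliashberg–Mishachev
route to Phillips' theorem
(`Literature.Topology.Immersions.Phillips1967_exists_isLocalDiffeomorph_of_isParallelizable`):
the hypotheses of `Phillips1967_exists_isLocalDiffeomorph_of_isParallelizable_of_compressibleExhaustion`
(an exhaustion `K` with extension steps near sets `A j` and compression data) are produced from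
a proper Morse function without critical points of index `dim M` (Phillips 1967, Lemma 1.1, the
tree's `exists_isMorse_tendsto_cocompact_forall_morseIndex_le`), the critical-level extension
(`HolonomicNear.criticalLevel`) and the compression data (`exists_isCompressionDatum_of_regular`,
`exists_isCompressionDatum_of_critical`), GIVEN holonomic approximation over cubes relative to a
collar in every positive codimension (`HasCubeCollarApprox`). Stages alternate: a critical stage
at each level `ℓᵢ` of a strictly increasing enumeration of the critical values (padded with the
natural numbers so that the enumeration is infinite and tends to `+∞`), then a regular stage up
to just below `ℓᵢ₊₁`.

* `Literature.Topology.Immersions.exists_strictMono_levels` — enumeration of a locally finite,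
  upward-unbounded set of reals from a given element.
* `Literature.Topology.Immersions.HolonomicNear.criticalLevel_finset` — the critical-level
  extension for finitely many critical points on one level, one after the other.
* `Literature.Topology.Immersions.Phillips1967_exists_isLocalDiffeomorph_of_isParallelizable_of_hasCubeCollarApprox`
  — **Phillips' theorem from holonomic approximation over cubes**.

## References

* A. Phillips, *Submersions of open manifolds*, Topology **6** (1967), Lemma 1.1, Cor. 1.2, §6.
  [Phillips1967]
* J. Milnor, *Morse theory* (1963), §3. [Milnor1963]
* Y. Eliashberg, N. Mishachev, *Introduction to the h-principle*, GSM 48 (2002), Thm. 3.1.1,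
  §4. [EliashbergMishachev2001]
-/

open scoped Manifold ContDiff Topology
open Set Function Filter Bundle Module Metric

noncomputable section

namespace Literature.Topology.Immersions

open Literature.Topology.FourManifolds

/-! ### Enumerating the levels -/

/-- **Enumeration of a locally finite set of levels**: if `E ⊆ ℝ` meets every `(-∞, b]` in a
finite set and contains all natural numbers, then from any `v₀` there is a strictly increasing
sequence `ℓ₀ = v₀ < ℓ₁ < ⋯ → +∞` such that no element of `E` lies strictly between consecutive
terms (`ℓᵢ₊₁` is the least element of `E` above `ℓᵢ`). [folklore] -/
theorem exists_strictMono_levels {E : Set ℝ} (hfin : ∀ b : ℝ, (E ∩ Iic b).Finite)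
    (hnat : ∀ m : ℕ, (m : ℝ) ∈ E) (v₀ : ℝ) :
    ∃ lev : ℕ → ℝ, lev 0 = v₀ ∧ StrictMono lev ∧ Tendsto lev atTop atTop ∧
      (∀ i, lev (i + 1) ∈ E) ∧ ∀ i, ∀ v ∈ E, lev i < v → lev (i + 1) ≤ v := by
  -- the least element of `E` above `t`
  have hnext : ∀ t : ℝ, ∃ w ∈ E, t < w ∧ ∀ v ∈ E, t < v → w ≤ v := by
    intro t
    obtain ⟨m, hm⟩ := exists_nat_gt t
    set S : Set ℝ := E ∩ Iic m ∩ Ioi t with hS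
    have hSf : S.Finite := (hfin m).subset (inter_subset_left (s := E ∩ Iic (m : ℝ)) (t := Ioi t))
    have hSne : S.Nonempty := ⟨m, ⟨hnat m, show (m : ℝ) ≤ m from le_rfl⟩, hm⟩
    obtain ⟨w, hwS, hwmin⟩ := Set.exists_min_image S id hSf hSne
    refine ⟨w, hwS.1.1, hwS.2, fun v hv htv => ?_⟩
    rcases le_or_gt v m with hvm | hvm
    · exact hwmin v ⟨⟨hv, hvm⟩, htv⟩
    · exact le_trans hwS.1.2 hvm.le
  choose nx hnxE hnxlt hnxle using hnext
  set lev : ℕ → ℝ := fun i => Nat.rec v₀ (fun _ t => nx t) i with hlev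
  have hsucc : ∀ i, lev (i + 1) = nx (lev i) := fun i => rfl
  have hmono : StrictMono lev := strictMono_nat_of_lt_succ fun i => by
    rw [hsucc]; exact hnxlt _
  refine ⟨lev, rfl, hmono, ?_, fun i => by rw [hsucc]; exact hnxE _,
    fun i v hv hlt => by rw [hsucc]; exact hnxle _ v hv hlt⟩
  -- unboundedness from local finiteness
  refine tendsto_atTop_atTop.2 fun b => ?_
  by_contra hcon
  simp only [not_exists, not_forall, not_le, exists_prop] at hcon
  have hbd : ∀ i, lev i ≤ b := fun i => by
    obtain ⟨j, hij, hj⟩ := hcon i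
    exact (hmono.monotone hij).trans hj.le
  have hinj : Injective fun i => lev (i + 1) := fun i j h => by
    have h' : lev (i + 1) = lev (j + 1) := h
    have : i + 1 = j + 1 := hmono.injective h'
    omega
  have hinf : (range fun i => lev (i + 1)).Infinite := infinite_range_of_injective hinj
  refine hinf ((hfin b).subset ?_)
  rintro _ ⟨i, rfl⟩
  exact ⟨show lev (i + 1) ∈ E by rw [hsucc]; exact hnxE _, show lev (i + 1) ≤ b from hbd (i + 1)⟩


/-! ### Several critical points on one level -/

section Finset

variable {n : ℕ} {M : Type*} [TopologicalSpace M]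
  [ChartedSpace (EuclideanSpace ℝ (Fin (n + 2))) M] [IsManifold (𝓡 (n + 2)) ∞ M] [T2Space M]

/-- Local notation: the model space `ℝⁿ⁺²`. -/
local notation "𝔼₂" => EuclideanSpace ℝ (Fin (n + 2))

/-- **Extension at a critical level with finitely many critical points** (Phillips 1967, §6;
Milnor 1963, Remark 3.3): `HolonomicNear.criticalLevel` applied to the critical points one after
the other, in pairwise disjoint Morse charts `e i` of common radius `R`; the result is
holonomic near `{ℓ ≤ c - 16(n+2)ε₂} ∪ ⋃ᵢ (e i)⁻¹([-4√(n+2)√ε₂, 4√(n+2)√ε₂]^{kᵢ} × 0)` and unchanged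
off the chart balls `(e i)⁻¹B(0, R)`. [cite: Phillips1967, §6] -/
theorem HolonomicNear.criticalLevel_finset {ι : Type*} [Fintype ι]
    {σ : Fin (n + 2) → M → 𝔼₂}
    (hσ : ∀ i, Continuous fun x => (⟨x, σ i x⟩ : TangentBundle (𝓡 (n + 2)) M))
    (hli : ∀ x, LinearIndependent ℝ fun i => σ i x) {f : M → 𝔼₂} {Ψ : M → Fin (n + 2) → 𝔼₂}
    {U' : Set M} (h : HolonomicNear σ f Ψ U') (hU'c : IsClosed U')
    (hcube : ∀ k, 1 ≤ k → k ≤ n + 1 → HasCubeCollarApprox n k)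
    {ℓ : M → ℝ} (hℓ : ContMDiff (𝓡 (n + 2)) 𝓘(ℝ, ℝ) ∞ ℓ) {c ε₂ : ℝ} (hε₂ : 0 < ε₂)
    {k : ι → ℕ} (hk : ∀ i, k i ≤ n + 1)
    {e : ι → OpenPartialHomeomorph M 𝔼₂} (he : ∀ i, e i ∈ IsManifold.maximalAtlas (𝓡 (n + 2)) ∞ M)
    (hdisj : Pairwise fun i j => Disjoint (e i).source (e j).source)
    {R : ℝ} (hR : 0 < R) (hRe : ∀ i, closedBall (0 : 𝔼₂) R ⊆ (e i).target)
    (hℓe : ∀ i, ∀ y ∈ (e i).target, ℓ ((e i).symm y) = c - lowSq (k i) y + highSq (k i) y)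
    (hsmall : 25 * (n + 2) ^ 2 * ε₂ < R ^ 2)
    (hU' : ∀ x, ℓ x ≤ c - ε₂ → x ∈ U') :
    ∃ (g : M → 𝔼₂) (Ψ' : M → Fin (n + 2) → 𝔼₂),
      HolonomicNear σ g Ψ' ({x | ℓ x ≤ c - 16 * (n + 2) * ε₂} ∪
        ⋃ i, (e i).symm '' planeCube (k i) (4 * Real.sqrt (n + 2) * Real.sqrt ε₂)) ∧
      ∀ x, (∀ i, x ∉ (e i).symm '' ball (0 : 𝔼₂) R) → g x = f x ∧ Ψ' x = Ψ x := by
  classical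
  -- names
  set ε' : ℝ := 16 * (n + 2) * ε₂ with hε'
  set qC : ℝ := 4 * Real.sqrt (n + 2) * Real.sqrt ε₂ with hqC
  set N : ι → Set M := fun i => (e i).symm '' ball (0 : 𝔼₂) R with hN
  set core : ι → Set M := fun i => (e i).symm '' planeCube (k i) qC with hcore
  have hballt : ∀ i, ball (0 : 𝔼₂) R ⊆ (e i).target := fun i => ball_subset_closedBall.trans (hRe i)
  have hNopen : ∀ i, IsOpen (N i) := fun i =>
    (e i).symm.isOpen_image_of_subset_source isOpen_ball (hballt i)
  have hNsrc : ∀ i, N i ⊆ (e i).source := by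
    rintro i _ ⟨y, hy, rfl⟩; exact (e i).map_target (hballt i hy)
  have hQball : ∀ i, planeCube (m := n + 2) (k i) qC ⊆ ball (0 : 𝔼₂) R := fun i => by
    have hk' : ((k i : ℕ) : ℝ) ≤ (n : ℝ) + 2 := by
      have := hk i; exact_mod_cast (this.trans (Nat.le_succ _))
    have := planeCube_subset_ball_of_le (m := n + 2) (k := k i) hk' (by
      have : (0:ℝ) ≤ n := by positivity
      linarith) hε₂ hR (by exact_mod_cast hsmall)
    simpa [hqC] using this
  have hcoreN : ∀ i, core i ⊆ N i := fun i => image_mono (hQball i)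
  have hcore_closed : ∀ i, IsClosed (core i) := fun i =>
    ((isCompact_planeCube (k i) qC).image_of_continuousOn
      ((e i).continuousOn_symm.mono ((hQball i).trans (hballt i)))).isClosed
  have hNdisj : ∀ i j, i ≠ j → Disjoint (N i) (N j) := fun i j hij =>
    (hdisj hij).mono (hNsrc i) (hNsrc j)
  have hε'ε : ε₂ ≤ ε' := by
    rw [hε']
    have : (0 : ℝ) ≤ n := by positivity
    nlinarith
  have hlevU' : {x | ℓ x ≤ c - ε'} ⊆ U' := fun x hx => hU' x (le_trans hx (by linarith))
  -- induction over finite sets of treated critical points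
  have key : ∀ s : Finset ι, ∃ (g : M → 𝔼₂) (Ψ' : M → Fin (n + 2) → 𝔼₂),
      HolonomicNear σ g Ψ' ((U' \ ⋃ i ∈ s, N i) ∪ {x | ℓ x ≤ c - ε'} ∪ ⋃ i ∈ s, core i) ∧
      ∀ x, (∀ i ∈ s, x ∉ N i) → g x = f x ∧ Ψ' x = Ψ x := by
    intro s
    induction s using Finset.induction_on with
    | empty =>
      refine ⟨f, Ψ, h.mono ?_, fun x _ => ⟨rfl, rfl⟩⟩
      rintro x ((hx | hx) | hx)
      · exact hx.1
      · exact hlevU' hx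
      · simp at hx
    | @insert i₀ s hi₀ ih =>
      obtain ⟨g₁, Ψ₁, h₁, heq₁⟩ := ih
      set U₁ : Set M := (U' \ ⋃ i ∈ s, N i) ∪ {x | ℓ x ≤ c - ε'} ∪ ⋃ i ∈ s, core i with hU₁
      have hU₁c : IsClosed U₁ := by
        refine ((hU'c.sdiff (isOpen_biUnion fun i _ => hNopen i)).union
          (isClosed_le hℓ.continuous continuous_const)).union ?_
        exact Set.Finite.isClosed_biUnion s.finite_toSet fun i _ => hcore_closed i
      have hU₁N : ∀ x ∈ N i₀, ℓ x ≤ c - ε₂ → x ∈ U₁ := by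
        intro x hx hxl
        refine Or.inl (Or.inl ⟨hU' x hxl, fun hx' => ?_⟩)
        obtain ⟨i, hi⟩ := mem_iUnion.1 hx'
        obtain ⟨his, hxi⟩ := mem_iUnion.1 hi
        have hne : i ≠ i₀ := fun h => hi₀ (h ▸ his)
        exact (hNdisj i i₀ hne).le_bot ⟨hxi, hx⟩
      have hU₁ε : ∀ x, ℓ x ≤ c - 16 * (n + 2) * ε₂ → x ∈ U₁ := fun x hx => Or.inl (Or.inr hx)
      obtain ⟨g₂, Ψ₂, h₂, heq₂⟩ := h₁.criticalLevel hσ hli hU₁c ((hk i₀).trans (Nat.le_succ _))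
        (fun hk1 => hcube (k i₀) hk1 (hk i₀)) hℓ hε₂ (he i₀) hR (hRe i₀) (hℓe i₀) hsmall hU₁N hU₁ε
      refine ⟨g₂, Ψ₂, h₂.mono ?_, fun x hx => ?_⟩
      · rintro x ((hx | hx) | hx)
        · -- `x ∈ U' \ ⋃_{insert i₀ s} N`
          have hx₀ : x ∉ N i₀ := fun h' => hx.2 (mem_biUnion (s.mem_insert_self i₀) h')
          have hxs : x ∉ ⋃ i ∈ s, N i := fun h' => by
            obtain ⟨i, hi⟩ := mem_iUnion.1 h'
            obtain ⟨his, hxi⟩ := mem_iUnion.1 hi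
            exact hx.2 (mem_biUnion (Finset.mem_insert_of_mem his) hxi)
          exact Or.inl (Or.inl ⟨Or.inl (Or.inl ⟨hx.1, hxs⟩), hx₀⟩)
        · exact Or.inl (Or.inr hx)
        · obtain ⟨i, hi⟩ := mem_iUnion.1 hx
          obtain ⟨hiins, hxi⟩ := mem_iUnion.1 hi
          rcases Finset.mem_insert.1 hiins with rfl | his
          · exact Or.inr hxi
          · have hne : i ≠ i₀ := fun h => hi₀ (h ▸ his)
            have hx₀ : x ∉ N i₀ := fun h' => (hNdisj i i₀ hne).le_bot ⟨hcoreN i hxi, h'⟩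
            exact Or.inl (Or.inl ⟨Or.inr (mem_biUnion his hxi), hx₀⟩)
      · have hx₀ : x ∉ N i₀ := hx i₀ (s.mem_insert_self i₀)
        have h2 := heq₂ x (fun hxs hball => hx₀ ⟨e i₀ x, hball, (e i₀).left_inv hxs⟩)
        have h1 := heq₁ x (fun i his => hx i (Finset.mem_insert_of_mem his))
        exact ⟨h2.1.trans h1.1, h2.2.trans h1.2⟩
  obtain ⟨g, Ψ', hg, heq⟩ := key Finset.univ
  refine ⟨g, Ψ', hg.mono ?_, fun x hx => heq x fun i _ => hx i⟩
  rintro x (hx | hx)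
  · exact Or.inl (Or.inr hx)
  · obtain ⟨i, hxi⟩ := mem_iUnion.1 hx
    exact Or.inr (mem_biUnion (Finset.mem_univ i) hxi)

end Finset


/-! ### Morse charts at the critical points of one level -/

section LevelCharts

variable {n : ℕ} {M : Type*} [TopologicalSpace M]
  [ChartedSpace (EuclideanSpace ℝ (Fin (n + 2))) M] [IsManifold (𝓡 (n + 2)) ∞ M] [T2Space M]

/-- Local notation: the model space `ℝⁿ⁺²`. -/
local notation "𝔼₂" => EuclideanSpace ℝ (Fin (n + 2))

/-- **Disjoint Morse charts of a common radius at the critical points of one level** (Morse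
lemma, the tree's `IsMorse.exists_chart_eq_quadratic_holds`, restricted to pairwise disjoint
neighbourhoods of the finitely many points): charts `e p` of the maximal atlas with pairwise
disjoint sources, `(e p)⁻¹ 0 = p`, `B̄(0, R) ⊆ (e p).target` for one `R ∈ (0, ρ]`, on whose targets
`ℓ ∘ (e p)⁻¹ = c - |y'|² + |y''|²` with `|y'|² = Σ_{i < k p} yᵢ²`, `k p` the Morse index.
[cite: Milnor1963, Lemma 2.2] -/
theorem exists_levelCharts {ℓ : M → ℝ} (hℓ : IsMorse (𝓡 (n + 2)) ℓ) {b : ℕ}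
    (hidx : ∀ x, IsMCriticalPt (𝓡 (n + 2)) ℓ x → morseIndex (𝓡 (n + 2)) ℓ x ≤ b)
    {c : ℝ} {P : Set M} (hPfin : P.Finite)
    (hP : ∀ p ∈ P, IsMCriticalPt (𝓡 (n + 2)) ℓ p ∧ ℓ p = c) {ρ : ℝ} (hρ : 0 < ρ) :
    ∃ (R : ℝ) (e : P → OpenPartialHomeomorph M 𝔼₂) (k : P → ℕ), 0 < R ∧ R ≤ ρ ∧
      (∀ p, e p ∈ IsManifold.maximalAtlas (𝓡 (n + 2)) ∞ M) ∧
      (Pairwise fun p q => Disjoint (e p).source (e q).source) ∧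
      (∀ p, closedBall (0 : 𝔼₂) R ⊆ (e p).target) ∧
      (∀ p, ∀ y ∈ (e p).target, ℓ ((e p).symm y) = c - lowSq (k p) y + highSq (k p) y) ∧
      (∀ p, (e p).symm 0 = (p : M)) ∧ ∀ p, k p ≤ b := by
  classical
  -- Morse charts
  have hM : ∀ p : P, ∃ e : OpenPartialHomeomorph M 𝔼₂,
      e ∈ IsManifold.maximalAtlas (𝓡 (n + 2)) ∞ M ∧ (p : M) ∈ e.source ∧ e p = 0 ∧
      ∀ y ∈ e.target, ℓ (e.symm y) = c - lowSq (morseIndex (𝓡 (n + 2)) ℓ (p : M)) y +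
        highSq (morseIndex (𝓡 (n + 2)) ℓ (p : M)) y := by
    intro p
    obtain ⟨e, he, hpe, hep, hform⟩ :=
      IsMorse.exists_chart_eq_quadratic_holds (n := n + 2) (M := M) hℓ (hP p p.2).1
    refine ⟨e, he, hpe, hep, fun y hy => ?_⟩
    rw [hform y hy, (hP p p.2).2]
    rfl
  choose e₀ he₀ hpe₀ hep₀ hform₀ using hM
  -- disjoint neighbourhoods of the points
  obtain ⟨U, hU, hUdisj⟩ := hPfin.t2_separation
  set e₁ : P → OpenPartialHomeomorph M 𝔼₂ := fun p => (e₀ p).restr (U p) with he₁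
  have he₁atlas : ∀ p, e₁ p ∈ IsManifold.maximalAtlas (𝓡 (n + 2)) ∞ M := fun p =>
    restr_mem_maximalAtlas (G := contDiffGroupoid ∞ (𝓡 (n + 2))) (he₀ p) (hU (p : M)).2
  have he₁src : ∀ p, (e₁ p).source = (e₀ p).source ∩ U p := fun p => by
    simp only [he₁, OpenPartialHomeomorph.restr_source, (hU (p : M)).2.interior_eq]
  have hdisj : Pairwise fun p q => Disjoint (e₁ p).source (e₁ q).source := by
    intro p q hpq
    rw [he₁src, he₁src]
    have hpq' : (p : M) ≠ q := fun h => hpq (Subtype.ext h)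
    exact (hUdisj p.2 q.2 hpq').mono inter_subset_right inter_subset_right
  have hp₁ : ∀ p, (p : M) ∈ (e₁ p).source := fun p => by
    rw [he₁src]; exact ⟨hpe₀ p, (hU (p : M)).1⟩
  have h0t : ∀ p, (0 : 𝔼₂) ∈ (e₁ p).target := fun p => by
    have := (e₁ p).map_source (hp₁ p)
    simpa [he₁, hep₀ p] using this
  -- a common radius
  have hr : ∀ p : P, ∃ r > 0, closedBall (0 : 𝔼₂) r ⊆ (e₁ p).target := fun p => by
    obtain ⟨r, hr, hball⟩ := Metric.isOpen_iff.1 (e₁ p).open_target 0 (h0t p)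
    exact ⟨r / 2, by positivity, (closedBall_subset_ball (by linarith)).trans hball⟩
  choose r hr hrball using hr
  obtain ⟨R, hR, hRρ, hRr⟩ : ∃ R > 0, R ≤ ρ ∧ ∀ p, R ≤ r p := by
    rcases isEmpty_or_nonempty P with hP0 | hP0
    · exact ⟨ρ, hρ, le_rfl, fun p => (hP0.false p).elim⟩
    · haveI : Finite P := hPfin.to_subtype
      obtain ⟨p₀, hp₀⟩ := Finite.exists_min r
      exact ⟨min ρ (r p₀), lt_min hρ (hr p₀), min_le_left _ _,
        fun p => (min_le_right _ _).trans (hp₀ p)⟩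
  refine ⟨R, e₁, fun p => morseIndex (𝓡 (n + 2)) ℓ (p : M), hR, hRρ, he₁atlas, hdisj,
    fun p => (closedBall_subset_closedBall (hRr p)).trans (hrball p), fun p y hy => ?_,
    fun p => ?_, fun p => hidx p (hP p p.2).1⟩
  · have hy' : y ∈ (e₀ p).target := by
      simp only [he₁, OpenPartialHomeomorph.restr_target] at hy
      exact hy.1
    have := hform₀ p y hy'
    simpa [he₁] using this
  · have := (e₁ p).left_inv (hp₁ p)
    simpa [he₁, hep₀ p] using this

end LevelCharts


/-! ### The exhaustion and Phillips' theorem -/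

section Assembly

variable {n : ℕ}

/-- Local notation: the model space `ℝⁿ⁺²`. -/
local notation "𝔼₂" => EuclideanSpace ℝ (Fin (n + 2))

/-- **The compressible exhaustion of an open manifold** (Phillips 1967, Cor. 1.2 and §6, in the
form consumed by `Phillips1967_exists_isLocalDiffeomorph_of_isParallelizable_of_compressibleExhaustion`):
from a proper Morse function `ℓ ≥ 0` without critical points of index `n + 2 = dim M` (Lemma
1.1), the levels `ℓ₀ < ℓ₁ < ⋯` (the critical values, padded with `ℕ`), the stages
`K (2i+1) = {ℓ ≤ ℓᵢ - ε₂ᵢ}`, `K (2i+2) = {ℓ ≤ ℓᵢ + εuᵢ}`, `K 0 = K 1 = ∅`, the extension sets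
`A (2i) = {ℓ ≤ ℓᵢ - ε'ᵢ} ∪ ⋃ (cores of the critical points at level ℓᵢ)` (reached by
`HolonomicNear.criticalLevel_finset`, GIVEN `HasCubeCollarApprox n k` for `1 ≤ k ≤ n + 1`) and
`A (2i+1) = K (2i+2)`, with the compression data of `exists_isCompressionDatum_of_critical` /
`exists_isCompressionDatum_of_regular`. [cite: Phillips1967, Cor. 1.2 and §6] -/
theorem exists_compressibleExhaustion (hcube : ∀ k, 1 ≤ k → k ≤ n + 1 → HasCubeCollarApprox n k)
    {M : Type*} [TopologicalSpace M] [T2Space M] [SecondCountableTopology M]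
    [ChartedSpace 𝔼₂ M] [IsManifold (𝓡 (n + 2)) ∞ M] [ConnectedSpace M] [NoncompactSpace M]
    (σ : Fin (n + 2) → M → 𝔼₂)
    (hσ : ∀ i, Continuous fun x => (⟨x, σ i x⟩ : TangentBundle (𝓡 (n + 2)) M))
    (hli : ∀ x, LinearIndependent ℝ fun i => σ i x) :
    ∃ K A : ℕ → Set M, (∀ j, K j ⊆ K (j + 1)) ∧ (∀ x, ∃ j, x ∈ interior (K j)) ∧ K 1 = ∅ ∧
      (∀ (j : ℕ) (f : M → 𝔼₂) (Ψ : M → Fin (n + 2) → 𝔼₂), HolonomicNear σ f Ψ (K (j + 1)) →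
        ∃ (g : M → 𝔼₂) (Ψ' : M → Fin (n + 2) → 𝔼₂), HolonomicNear σ g Ψ' (A j) ∧ EqOn g f (K j)) ∧
      (∀ (j : ℕ) (V : Set M), IsOpen V → A j ⊆ V →
        ∃ (Φ : ℝ × M → M) (τ : M → ℝ) (W : Set M), IsCompressionDatum (n + 2) Φ τ W (K j) (K (j + 2)) V) := by
  classical
  haveI : LocallyCompactSpace M := ChartedSpace.locallyCompactSpace 𝔼₂ M
  haveI : SigmaCompactSpace M := sigmaCompactSpace_of_locallyCompact_secondCountable
  -- ### a proper Morse function without critical points of top index (Phillips, Lemma 1.1)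
  have hopen : ∀ x : M, ¬ IsCompact (connectedComponent x) := fun x hx => by
    rw [PreconnectedSpace.connectedComponent_eq_univ x] at hx
    exact noncompact_univ M hx
  obtain ⟨ℓ, hℓM, -, hℓT, hidx⟩ :=
    exists_isMorse_tendsto_cocompact_forall_morseIndex_le (k := n + 1) (M := M) hopen
  have hℓs : ContMDiff (𝓡 (n + 2)) 𝓘(ℝ, ℝ) ∞ ℓ := hℓM.1
  have hsub : ∀ b : ℝ, IsCompact (ℓ ⁻¹' Iic b) := fun b =>
    isCompact_preimage_Iic_of_tendsto_cocompact hℓs.continuous hℓT b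
  -- ### the levels
  set E : Set ℝ := ℓ '' criticalSet (𝓡 (n + 2)) ℓ ∪ range (fun m : ℕ => (m : ℝ)) with hE
  have hEfin : ∀ b : ℝ, (E ∩ Iic b).Finite := by
    intro b
    have h1 : (ℓ '' criticalSet (𝓡 (n + 2)) ℓ ∩ Iic b).Finite := by
      refine ((finite_criticalSet_inter_of_isCompact_of_isMorse hℓM (hsub b)).image ℓ).subset ?_
      rintro _ ⟨⟨x, hx, rfl⟩, hb⟩
      exact ⟨x, ⟨hx, hb⟩, rfl⟩
    have h2 : (range (fun m : ℕ => (m : ℝ)) ∩ Iic b).Finite := by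
      refine ((Set.finite_Iic ⌊b⌋₊).image (fun m : ℕ => (m : ℝ))).subset ?_
      rintro _ ⟨⟨m, rfl⟩, hm⟩
      exact ⟨m, Nat.le_floor hm, rfl⟩
    rw [hE, union_inter_distrib_right]
    exact h1.union h2
  obtain ⟨x₀, hx₀⟩ := hℓs.continuous.exists_forall_le hℓT
  obtain ⟨lev, hlev0, hmono, htend, -, hleast⟩ :=
    exists_strictMono_levels hEfin (fun m => Or.inr ⟨m, rfl⟩) (ℓ x₀)
  have hL1 : ∀ x, lev 0 ≤ ℓ x := fun x => by rw [hlev0]; exact hx₀ x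
  have hcritE : ∀ x, IsMCriticalPt (𝓡 (n + 2)) ℓ x → ℓ x ∈ E := fun x hx =>
    Or.inl ⟨x, hx, rfl⟩
  have hnocrit : ∀ i x, IsMCriticalPt (𝓡 (n + 2)) ℓ x → lev i < ℓ x → lev (i + 1) ≤ ℓ x :=
    fun i x hx => hleast i _ (hcritE x hx)
  set gap : ℕ → ℝ := fun i => lev (i + 1) - lev i with hgap
  have hgap_pos : ∀ i, 0 < gap i := fun i => by
    simp only [hgap]; linarith [hmono (Nat.lt_succ_self i)]
  set G : ℕ → ℝ := fun i => if i = 0 then gap 0 else min (gap i) (gap (i - 1)) with hG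
  have hG_pos : ∀ i, 0 < G i := fun i => by
    simp only [hG]; split_ifs
    · exact hgap_pos 0
    · exact lt_min (hgap_pos _) (hgap_pos _)
  have hG_le : ∀ i, G i ≤ gap i := fun i => by
    simp only [hG]; split_ifs with h
    · rw [h]
    · exact min_le_left _ _
  have hG_le' : ∀ i, 1 ≤ i → G i ≤ gap (i - 1) := fun i hi => by
    have : i ≠ 0 := by omega
    simp only [hG, this, if_false]
    exact min_le_right _ _
  -- a critical value within `G i` of `lev i` is `lev i`
  have hL3 : ∀ i x, IsMCriticalPt (𝓡 (n + 2)) ℓ x → lev i - G i < ℓ x → ℓ x < lev i + G i →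
      ℓ x = lev i := by
    intro i x hx hlo hhi
    rcases lt_trichotomy (ℓ x) (lev i) with hlt | heq | hgt
    · exfalso
      rcases Nat.eq_zero_or_pos i with rfl | hi
      · linarith [hL1 x]
      · have h1 : lev (i - 1) < ℓ x := by
          have := hG_le' i hi
          have h2 : gap (i - 1) = lev i - lev (i - 1) := by
            simp only [hgap]; rw [Nat.sub_add_cancel hi]
          linarith
        have := hnocrit (i - 1) x hx h1
        rw [Nat.sub_add_cancel hi] at this
        linarith
    · exact heq
    · exfalso
      have := hnocrit i x hx hgt
      have := hG_le i
      simp only [hgap] at this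
      linarith
  -- ### the critical points on each level and their charts
  set P : ℕ → Set M := fun i => {x | IsMCriticalPt (𝓡 (n + 2)) ℓ x ∧ ℓ x = lev i} with hP
  have hPfin : ∀ i, (P i).Finite := fun i => by
    refine (finite_criticalSet_inter_of_isCompact_of_isMorse hℓM (hsub (lev i))).subset ?_
    rintro x ⟨hx, hxl⟩
    exact ⟨hx, show ℓ x ≤ lev i from hxl.le⟩
  have hPmem : ∀ i, ∀ p ∈ P i, IsMCriticalPt (𝓡 (n + 2)) ℓ p ∧ ℓ p = lev i := fun i p hp => hp
  set ρ : ℕ → ℝ := fun i => min 1 (G i / 16) with hρ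
  have hρpos : ∀ i, 0 < ρ i := fun i => lt_min one_pos (by have := hG_pos i; positivity)
  choose R e k hR hRρ heA hdisj hRe hform hsymm0 hk using
    fun i => exists_levelCharts hℓM hidx (hPfin i) (hPmem i) (hρpos i)
  haveI : ∀ i, Fintype (P i) := fun i => (hPfin i).fintype
  -- sizes
  have hR1 : ∀ i, R i ≤ 1 := fun i => (hRρ i).trans (min_le_left _ _)
  have hRG : ∀ i, R i ^ 2 ≤ G i / 16 := fun i => by
    have h1 : R i ^ 2 ≤ R i := by nlinarith [hR i, hR1 i]
    exact h1.trans ((hRρ i).trans (min_le_right _ _))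
  -- ### constants
  set ε₂ : ℕ → ℝ := fun i => R i ^ 2 / (400 * ((n : ℝ) + 2) ^ 2) with hε₂
  set ε' : ℕ → ℝ := fun i => 16 * ((n : ℝ) + 2) * ε₂ i with hε'
  set εu : ℕ → ℝ := fun i => G i / 10 with hεu
  have hn0 : (0 : ℝ) ≤ n := by positivity
  have hn2 : (2 : ℝ) ≤ (n : ℝ) + 2 := by linarith
  have hn4 : (4 : ℝ) ≤ ((n : ℝ) + 2) ^ 2 := by nlinarith
  have hε₂pos : ∀ i, 0 < ε₂ i := fun i => by have := hR i; positivity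
  have hε₂R : ∀ i, ε₂ i ≤ R i ^ 2 / 1600 := fun i => by
    simp only [hε₂]
    rw [div_le_div_iff₀ (by positivity) (by positivity)]
    have := hR i
    nlinarith [sq_nonneg (R i), hn4]
  have hε'R : ∀ i, ε' i ≤ R i ^ 2 / 50 := fun i => by
    simp only [hε', hε₂]
    rw [show 16 * ((n : ℝ) + 2) * (R i ^ 2 / (400 * ((n : ℝ) + 2) ^ 2)) =
      R i ^ 2 / (25 * ((n : ℝ) + 2)) by field_simp; ring]
    rw [div_le_div_iff₀ (by positivity) (by positivity)]
    nlinarith [sq_nonneg (R i)]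
  have hε₂G : ∀ i, ε₂ i ≤ G i / 25600 := fun i => by linarith [hε₂R i, hRG i]
  have hε'G : ∀ i, ε' i ≤ G i / 800 := fun i => by linarith [hε'R i, hRG i]
  have hε'pos : ∀ i, 0 < ε' i := fun i => by have := hε₂pos i; positivity
  have hsmall : ∀ i, 25 * ((n : ℝ) + 2) ^ 2 * ε₂ i < R i ^ 2 := fun i => by
    simp only [hε₂]
    rw [show 25 * ((n : ℝ) + 2) ^ 2 * (R i ^ 2 / (400 * ((n : ℝ) + 2) ^ 2)) = R i ^ 2 / 16 by
      field_simp; ring]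
    have := hR i
    nlinarith [sq_nonneg (R i)]
  -- ### the exhaustion
  set KL : ℕ → ℝ := fun j => if j % 2 = 0 then lev (j / 2) - ε₂ (j / 2) else lev (j / 2) + εu (j / 2)
    with hKL
  set K : ℕ → Set M := fun j => if j = 0 then ∅ else {x | ℓ x ≤ KL (j - 1)} with hK
  set cores : ℕ → Set M := fun i =>
    ⋃ p, (e i p).symm '' planeCube (k i p) (4 * Real.sqrt (n + 2) * Real.sqrt (ε₂ i)) with hcores
  set A : ℕ → Set M := fun j => if j % 2 = 0 then {x | ℓ x ≤ lev (j / 2) - ε' (j / 2)} ∪ cores (j / 2)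
    else {x | ℓ x ≤ KL j} with hA
  -- unfolding lemmas
  have hK0 : K 0 = ∅ := by simp [hK]
  have hKsucc : ∀ j, K (j + 1) = {x | ℓ x ≤ KL j} := fun j => by simp [hK]
  have hKLe : ∀ i, KL (2 * i) = lev i - ε₂ i := fun i => by
    simp [hKL, Nat.mul_mod_right, Nat.mul_div_cancel_left i two_pos]
  have hKLo : ∀ i, KL (2 * i + 1) = lev i + εu i := fun i => by
    have h1 : (2 * i + 1) % 2 = 1 := by omega
    have h2 : (2 * i + 1) / 2 = i := by omega
    simp [hKL, h1, h2]
  have hAe : ∀ i, A (2 * i) = {x | ℓ x ≤ lev i - ε' i} ∪ cores i := fun i => by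
    simp [hA, Nat.mul_mod_right, Nat.mul_div_cancel_left i two_pos]
  have hAo : ∀ i, A (2 * i + 1) = K (2 * i + 2) := fun i => by
    have h1 : (2 * i + 1) % 2 = 1 := by omega
    rw [show 2 * i + 2 = (2 * i + 1) + 1 by ring, hKsucc]
    simp [hA, h1]
  -- chart balls are close to their level and away from the previous stage
  have hballt : ∀ i p, ball (0 : 𝔼₂) (R i) ⊆ (e i p).target := fun i p =>
    ball_subset_closedBall.trans (hRe i p)
  have hNlev : ∀ i p, ∀ x ∈ (e i p).symm '' ball (0 : 𝔼₂) (R i), lev i - R i ^ 2 < ℓ x := by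
    rintro i p _ ⟨y, hy, rfl⟩
    rw [hform i p y (hballt i p hy)]
    have h1 : lowSq (k i p) y ≤ ‖y‖ ^ 2 := by
      rw [← lowSq_add_highSq (k i p) y]; linarith [highSq_nonneg (k i p) y]
    have h2 : ‖y‖ < R i := by simpa using hy
    have h3 : ‖y‖ ^ 2 < R i ^ 2 := by
      exact pow_lt_pow_left₀ h2 (norm_nonneg _) two_ne_zero
    linarith [highSq_nonneg (k i p) y]
  have hprevN : ∀ i, 1 ≤ i → ∀ p, ∀ x ∈ K (2 * i), x ∉ (e i p).symm '' ball (0 : 𝔼₂) (R i) := by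
    intro i hi p x hx hxN
    have h1 := hNlev i p x hxN
    obtain ⟨i', rfl⟩ : ∃ i', i = i' + 1 := ⟨i - 1, by omega⟩
    rw [show 2 * (i' + 1) = (2 * i' + 1) + 1 by ring, hKsucc, mem_setOf_eq, hKLo] at hx
    have h2 := hG_le' (i' + 1) hi
    simp only [Nat.add_sub_cancel, hgap] at h2
    have h3 := hRG (i' + 1)
    have h4 := hG_le i'
    simp only [hgap] at h4
    have h5 : εu i' = G i' / 10 := rfl
    linarith [hG_pos i', hG_pos (i' + 1)]
  refine ⟨K, A, fun j => ?_, fun x => ?_, ?_, fun j f Ψ hf => ?_, fun j V hV hAV => ?_⟩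
  · -- ### monotonicity
    rcases Nat.eq_zero_or_pos j with rfl | hj
    · rw [hK0]; exact empty_subset _
    obtain ⟨i, hi⟩ := Nat.even_or_odd' (j - 1)
    rcases hi with hi | hi
    · have hj' : j = 2 * i + 1 := by omega
      subst hj'
      rw [hKsucc, show 2 * i + 1 + 1 = (2 * i + 1) + 1 by ring, hKsucc, hKLe, hKLo]
      intro x hx
      simp only [mem_setOf_eq] at hx ⊢
      have := hε₂pos i; have := hG_pos i
      have h5 : εu i = G i / 10 := rfl
      linarith
    · have hj' : j = 2 * i + 2 := by omega
      subst hj'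
      rw [show 2 * i + 2 = (2 * i + 1) + 1 by ring, hKsucc, hKLo,
        show 2 * i + 1 + 1 + 1 = (2 * (i + 1)) + 1 by ring, hKsucc, hKLe]
      intro x hx
      simp only [mem_setOf_eq] at hx ⊢
      have h1 := hG_le i
      have h2 := hε₂G (i + 1)
      have h3 := hG_le' (i + 1) (by omega)
      simp only [Nat.add_sub_cancel, hgap] at h1 h3
      have h5 : εu i = G i / 10 := rfl
      linarith [hG_pos i, hG_pos (i + 1)]
  · -- ### cover
    obtain ⟨i, hi⟩ := (htend.eventually (eventually_ge_atTop (ℓ x + 1))).exists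
    refine ⟨2 * i + 1, ?_⟩
    rw [hKsucc, hKLe]
    have hsub' : {y | ℓ y < lev i - ε₂ i} ⊆ {y | ℓ y ≤ lev i - ε₂ i} := fun y hy =>
      show ℓ y ≤ lev i - ε₂ i from le_of_lt hy
    refine interior_mono hsub' ?_
    rw [(isOpen_lt hℓs.continuous continuous_const).interior_eq]
    show ℓ x < lev i - ε₂ i
    have := hε₂R i; have := hR1 i
    nlinarith [hR i]
  · -- ### `K 1 = ∅`
    rw [show (1 : ℕ) = 0 + 1 from rfl, hKsucc, show (0 : ℕ) = 2 * 0 from rfl, hKLe]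
    ext x
    simp only [mem_setOf_eq, mem_empty_iff_false, iff_false, not_le]
    linarith [hL1 x, hε₂pos 0]
  · -- ### extension
    obtain ⟨i, rfl | rfl⟩ := Nat.even_or_odd' j
    · -- critical stage at `lev i`
      rw [hKsucc, hKLe] at hf
      obtain ⟨g, Ψ', hg, heq⟩ := HolonomicNear.criticalLevel_finset hσ hli hf
        (isClosed_le hℓs.continuous continuous_const) hcube hℓs (hε₂pos i) (hk i) (heA i)
        (hdisj i) (hR i) (hRe i) (hform i) (hsmall i) (fun x hx => hx)
      refine ⟨g, Ψ', ?_, fun x hx => (heq x fun p => ?_).1⟩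
      · rw [hAe]; exact hg
      · rcases Nat.eq_zero_or_pos i with rfl | hi
        · rw [show 2 * 0 = 0 from rfl, hK0] at hx; exact hx.elim
        · exact hprevN i hi p x hx
    · -- regular stage
      exact ⟨f, Ψ, by rw [hAo]; exact hf, fun x _ => rfl⟩
  · -- ### compression
    obtain ⟨i, rfl | rfl⟩ := Nat.even_or_odd' j
    · -- critical stage: Milnor's modified function
      rw [hAe] at hAV
      have hθ : 0 < G i / 10 := by have := hG_pos i; positivity
      refine exists_isCompressionDatum_of_critical hℓs (heA i) (hdisj i) (hR i) (hRe i)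
        (hform i) (hε'pos i) ?_ hθ hθ ?_ ?_ ?_ ?_ hV ?_ ?_
      · have := hε'R i; have := hR i; nlinarith [sq_nonneg (R i)]
      · exact (hsub _).of_isClosed_subset (isClosed_Icc.preimage hℓs.continuous)
          (fun x hx => hx.2)
      · intro x hx hcr
        have hxl : ℓ x = lev i := by
          refine hL3 i x hcr ?_ ?_
          · have := hε'G i; linarith [hx.1, hG_pos i]
          · have h5 : εu i = G i / 10 := rfl
            linarith [hx.2, hG_pos i]
        exact ⟨⟨x, hcr, hxl⟩, (hsymm0 i ⟨x, hcr, hxl⟩).symm⟩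
      · intro x hx
        rcases Nat.eq_zero_or_pos i with rfl | hi
        · rw [show 2 * 0 = 0 from rfl, hK0] at hx; exact hx.elim
        · obtain ⟨i', rfl⟩ : ∃ i', i = i' + 1 := ⟨i - 1, by omega⟩
          rw [show 2 * (i' + 1) = (2 * i' + 1) + 1 by ring, hKsucc, mem_setOf_eq, hKLo] at hx
          have h2 := hG_le' (i' + 1) hi
          simp only [Nat.add_sub_cancel, hgap] at h2
          have h4 := hG_le i'
          simp only [hgap] at h4
          have h5 : εu i' = G i' / 10 := rfl
          have h6 := hε'G (i' + 1)
          linarith [hG_pos i', hG_pos (i' + 1)]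
      · intro x hx
        rw [show 2 * i + 2 = (2 * i + 1) + 1 by ring, hKsucc, mem_setOf_eq, hKLo] at hx
        exact hx
      · intro x hx
        exact hAV (Or.inl hx)
      · intro p y hy h0 h1
        refine hAV (Or.inr (mem_iUnion.2 ⟨p, y, ?_, rfl⟩))
        refine mem_planeCube_of_disc (by positivity) h0 ?_
        have : (4 * Real.sqrt (n + 2) * Real.sqrt (ε₂ i)) ^ 2 = ε' i := by
          rw [mul_pow, mul_pow, Real.sq_sqrt (by positivity), Real.sq_sqrt (hε₂pos i).le]
          simp only [hε']; ring
        rw [this]; exact h1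
    · -- regular stage: push down along `ℓ`
      rw [hAo, show 2 * i + 2 = (2 * i + 1) + 1 by ring, hKsucc, hKLo] at hAV
      set δ : ℝ := min (ε₂ (i + 1) / 8) (εu i / 2) with hδ
      have hδpos : 0 < δ := lt_min (by have := hε₂pos (i + 1); positivity)
        (by have := hG_pos i; simp only [hεu]; positivity)
      have hδ₁ : δ ≤ ε₂ (i + 1) / 8 := min_le_left _ _
      have hδ₂ : δ ≤ εu i / 2 := min_le_right _ _
      have hgapi : lev (i + 1) - lev i = gap i := rfl
      have h5 : εu i = G i / 10 := rfl
      refine exists_isCompressionDatum_of_regular hℓs (a := lev i + εu i + δ)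
        (b := lev (i + 1) - ε₂ (i + 1) / 2) ?_ hδpos ?_ ?_ ?_ ?_ ?_
      · have := hG_le i; have := hε₂G (i + 1); have := hG_le' (i + 1) (by omega)
        simp only [Nat.add_sub_cancel] at *
        linarith [hG_pos i, hG_pos (i + 1), hε₂pos (i + 1)]
      · exact (hsub _).of_isClosed_subset (isClosed_Icc.preimage hℓs.continuous)
          (fun x hx => hx.2)
      · intro x hx hcr
        have h1 : lev i < ℓ x := by linarith [hx.1, hG_pos i]
        have h2 := hnocrit i x hcr h1
        linarith [hx.2, hε₂pos (i + 1)]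
      · intro x hx
        rw [hKsucc, mem_setOf_eq, hKLe] at hx
        linarith [hε₂pos i, hG_pos i]
      · intro x hx
        rw [show 2 * i + 1 + 2 = (2 * (i + 1)) + 1 by ring, hKsucc, mem_setOf_eq, hKLe] at hx
        linarith [hε₂pos (i + 1)]
      · intro x hx
        refine hAV ?_
        show ℓ x ≤ lev i + εu i
        linarith

/-- **Phillips' theorem on submersions of open parallelizable manifolds from holonomic
approximation over cubes** (Phillips 1967, Cor. 8.2 "if"; Eliashberg–Mishachev 2002, §4 and
Thm. 3.1.1): if holonomic approximation over cubes relative to a collar holds in every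
dimension `n + 2` for every `1 ≤ k ≤ n + 1` (`HasCubeCollarApprox n k`), then every open
parallelizable manifold admits a `C^∞` local diffeomorphism into the Euclidean space of its
dimension. [cite: Phillips1967, Cor. 8.2] -/
theorem Phillips1967_exists_isLocalDiffeomorph_of_isParallelizable_of_hasCubeCollarApprox
    (hcube : ∀ n k : ℕ, 1 ≤ k → k ≤ n + 1 → HasCubeCollarApprox n k) :
    Phillips1967_exists_isLocalDiffeomorph_of_isParallelizable := by
  refine Phillips1967_exists_isLocalDiffeomorph_of_isParallelizable_of_compressibleExhaustion
    fun m M _ _ _ _ _ _ _ σ hm hσ hli => ?_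
  obtain ⟨n, rfl⟩ : ∃ n, m = n + 2 := ⟨m - 2, by omega⟩
  exact exists_compressibleExhaustion (hcube n) σ hσ hli

end Assembly

end Literature.Topology.Immersions
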